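/-
Origin: expansion seat `planner-pub-hodgecm-toy-g2-0`, handover #31 2026-08-18T09:59:39Z (`HOME/pub-hodgecm-toy-g2/lean/ToyG2/G4Witness.lean`, md5 2feede44, 79 lines);
landed by the gen-7 packager in gate run 28 as `HodgeCM/Model/ToyG2/G4Witness.lean` (import ^import ToyG2\.→import HodgeCM.Model.ToyG2. ×1).
-/
/-
# HodgeCM.Model.ToyG2.G4Witness — the G4 consistency target of the `pub-hodgecm-toy` lineage from the two product steps

Generation 2 of the `pub-hodgecm-toy` lineage (seat `planner-pub-hodgecm-toy-g2-0`), joining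
* this seat's reduction of the 28 model axioms of `toyUniverse₃ d t` (good objects of the generation-2 toy category)
  to the two purely algebraic product statements `GenProdStep` (radicals, G1) and `HRProdStep` (Hodge–Riesz, G3):
  `toyUniverse₃_modelAxioms_of_prodSteps` (`RadicalProd`), with
* the expansion seat `planner-pub-hodgecm-pv03-g5-0`'s theta realisation of the period leaf on the same universe
  (`ThetaModel3`: `realisationExistsPerL₃`, `realisationExistsFace₃`, `endState₃_of_gysin`).

Result: `g4_witness_of_prodSteps : GenProdStep → HRProdStep → ∃ U, U.ModelAxioms ∧ U.RealisationExistsPerL ∧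
U.RealisationExistsFace` and, in the model, the package's end state `PerL ∧ PeriodThmF ∧ W_RK4`
(`endState₃_of_prodSteps`).  No hypothesis beyond the two product steps (DESIGN.md §9, generation-3 programme) and
the numerical side conditions `1 ≤ d`, `t ^ 2 = 16` of the theta realisation.

v2 (10:15Z): the product step `GenProdStep` is now a THEOREM (`genProdStep`, `RadicalProdStep`), so everything follows from the single
statement `HRProdStep` (Hodge–Riesz passes to binary products of good objects): **`g4_witness_of_hrProdStep : HRProdStep →
∃ U, U.ModelAxioms ∧ U.RealisationExistsPerL ∧ U.RealisationExistsFace`**, `endState₃_of_hrProdStep`.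
-/
import Mathlib
import Summits.HodgeConjecture.HodgeCM.Model.ToyG2.RadicalProdStep
import Summits.HodgeConjecture.HodgeCM.Model.ToyG2.ThetaModel3

/-! PORT of `HodgeCM/Model/ToyG2/G4Witness.lean` (HodgeCMPerL run 82) — verbatim mechanical port; provenance in the PORT header line. -/

namespace HodgeCM.ToyG2

open HodgeCM.Toy HodgeCM.Toy.CMPresentation
open Literature.AlgebraicGeometry.Motives
open HodgeCM.ToyG2.ThetaUiso

noncomputable section

/-- M26 (Gysin for good surfaces) in `toyUniverse₃ d t` from the two product steps -/
theorem gysin_surface₃_of_prodSteps (d t : ℚ) (h1 : GenProdStep) (h2 : HRProdStep) :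
    (toyUniverse₃ d t).Fact_gysin_surface :=
  (toyUniverse₃_modelAxioms_of_prodSteps d t h1 h2).gysin_surface

/-- `ModelAxioms ∧ RealisationExistsPerL ∧ RealisationExistsFace` for `toyUniverse₃ d t` from the two product steps -/
theorem g4_of_prodSteps (d t : ℚ) (hd : (1 : ℚ) ≤ d) (ht : t ^ 2 = 16) (h1 : GenProdStep) (h2 : HRProdStep) :
    (toyUniverse₃ d t).ModelAxioms ∧ (toyUniverse₃ d t).RealisationExistsPerL
      ∧ (toyUniverse₃ d t).RealisationExistsFace :=
  ⟨toyUniverse₃_modelAxioms_of_prodSteps d t h1 h2, realisationExistsPerL₃ d t hd ht,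
    realisationExistsFace₃ d t hd ht⟩

/-- **the G4 consistency witness from the two product steps**: at `d = 1`, `t = 4`,
`∃ U, U.ModelAxioms ∧ U.RealisationExistsPerL ∧ U.RealisationExistsFace` -/
theorem g4_witness_of_prodSteps (h1 : GenProdStep) (h2 : HRProdStep) :
    ∃ U : Universe, U.ModelAxioms ∧ U.RealisationExistsPerL ∧ U.RealisationExistsFace :=
  ⟨toyUniverse₃ 1 4, g4_of_prodSteps 1 4 le_rfl (by norm_num) h1 h2⟩

/-- in the model, from the two product steps: the package's end state `PerL ∧ PeriodThmF ∧ W_RK4` -/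
theorem endState₃_of_prodSteps (d t : ℚ) (hd : (1 : ℚ) ≤ d) (ht : t ^ 2 = 16) (h1 : GenProdStep) (h2 : HRProdStep) :
    (toyUniverse₃ d t).PerL ∧ (toyUniverse₃ d t).PeriodThmF ∧ (toyUniverse₃ d t).W_RK4 :=
  endState₃_of_gysin d t hd ht (gysin_surface₃_of_prodSteps d t h1 h2)

/-! ### v2: from `HRProdStep` alone (`genProdStep` is a theorem) -/

/-- (Ported verbatim from the HodgeCMPerL package; no docstring in the source.) -/
theorem g4_of_hrProdStep (d t : ℚ) (hd : (1 : ℚ) ≤ d) (ht : t ^ 2 = 16) (h : HRProdStep) :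
    (toyUniverse₃ d t).ModelAxioms ∧ (toyUniverse₃ d t).RealisationExistsPerL
      ∧ (toyUniverse₃ d t).RealisationExistsFace :=
  g4_of_prodSteps d t hd ht genProdStep h

/-- **the G4 consistency witness from Hodge–Riesz for products alone** -/
theorem g4_witness_of_hrProdStep (h : HRProdStep) :
    ∃ U : Universe, U.ModelAxioms ∧ U.RealisationExistsPerL ∧ U.RealisationExistsFace :=
  g4_witness_of_prodSteps genProdStep h

/-- (Ported verbatim from the HodgeCMPerL package; no docstring in the source.) -/
theorem endState₃_of_hrProdStep (d t : ℚ) (hd : (1 : ℚ) ≤ d) (ht : t ^ 2 = 16) (h : HRProdStep) :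
    (toyUniverse₃ d t).PerL ∧ (toyUniverse₃ d t).PeriodThmF ∧ (toyUniverse₃ d t).W_RK4 :=
  endState₃_of_prodSteps d t hd ht genProdStep h

/-- the same from Hodge–Riesz for all good objects (the form a generation-3 proof will most likely deliver) -/
theorem g4_witness_of_hodgeRiesz (h2 : ∀ X : Obj₂, X.Good → HodgeRiesz X) :
    ∃ U : Universe, U.ModelAxioms ∧ U.RealisationExistsPerL ∧ U.RealisationExistsFace :=
  ⟨toyUniverse₃ 1 4, toyUniverse₃_modelAxioms_of_hodgeRiesz 1 4 h2, realisationExistsPerL₃ 1 4 le_rfl (by norm_num),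
    realisationExistsFace₃ 1 4 le_rfl (by norm_num)⟩

end

end HodgeCM.ToyG2
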